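import Summits.QuantumFields.YangMills.Theorems.LangevinControlUVOSLegsAtWeakCouplingCStubInheritTorus
import HarnessLib

/-!
# Stub `stub_inherit` of line `inherited-amplitude-gates` (crux `OSLegsAtWeakCouplingC`, stmt-QuantumFields-16207):
# auxiliary file 2 — solving the η-relative gate for the flat-box axis covariance

The SOLVE step of the inheritance lemma.  For a femto cube `(c, b)`, an axis pair `(x', x' + m e₂)` of the
`(0,1)`-plane deep inside it, and the flat exterior `1`, the flat conditional covariance
`K(1) = kerCov_1(plane (0,1) x', plane (0,1) (x' + m e₂))` is pinned from H1's two-sided torus bounds: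

* embed the cube in the torus of side `b + 3` and read H1 there at separation `m` (auxiliary file 1,
  `h1Cov_eq_liftCov`): `c Γ(m a) ≤ m⁸ e ≤ C Γ(m a)` for the lifted covariance `e`;
* the law of total covariance (file 1, `abs_liftCov_plane_sub_integral_kerCov_le`) and FBL6 give
  `|e − E_T kerCov_η| ≤ 4 h²`, `h = C₁/(κ m)⁴`;
* FBL6 discharges the gate budget `M = 2C₁/((κ−2) m)⁴` uniformly in the exterior, so `GateAxis` averaged over
  `η ∼ T` gives `|E_T kerCov_η − K(1)| ≤ C_g (M √K(1) + M² + |K(1)|/κ²)`;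
* real arithmetic (`gate_abs_le`, `gate_lower`; `C_g κ⁻² ≤ 1/4`, `C_g M √K ≤ C_g² M² + |K|/4`, so positivity of
  `K(1)` is an OUTPUT): `m⁸ |K(1)| ≤ 2C + 8(1 + C_g + C_g²) C₁²/(κ−2)⁸` unconditionally (`Γ ≤ 1`), and
  `K(1) ≥ (2/3)(c K_f a⁸ − 4(1 + C_g + C_g²) C₁²/((κ−2)m)⁸)` whenever `Γ(m a) ≥ K_f (m a)⁸`.

Also the transfer lemmas `gate_transfer_abs_le` / `gate_transfer_lower` used downstream for `GateD`.

Refs: line card `Cruxes/OSLegsAtWeakCouplingC/Lines/inherited-amplitude-gates.md` (stub_inherit (iii)–(iv)); ideator's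
`gate_solve_lower/upper`, `gate_propagate` (`Cruxes/OSLegsAtWeakCouplingC/Sketch_ideator1.lean`) as the model.
-/

set_option autoImplicit false

noncomputable section

open scoped BigOperators
open MeasureTheory Filter Topology
open Literature.MathematicalPhysics.QuantumFieldTheory Literature.MathematicalPhysics.QuantumLattice
open Literature.MathematicalPhysics.AQFT Literature.Probability.LatticeModels
open Summit.QuantumFields.YangMills.Cruxes.OSLegsFromFemtoAndGap.DlrCollarTransfer
open Summit.QuantumFields.YangMills.Cruxes.OSLegsFromFemtoAndGap.DlrCollarTransfer.StubLower
open Summit.QuantumFields.YangMills.Theorems.OSLegsFromFemtoAndGap.StubLower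

namespace Summit.QuantumFields.YangMills.Cruxes.OSLegsAtWeakCouplingC.InheritedAmplitudeGates.StubInherit

/-! ### Real arithmetic of the gate -/

/-- The cross term of the gate: `C_g M √K ≤ C_g² M² + |K|/4` (AM–GM; `√K = 0` for `K ≤ 0`). [folklore] -/
theorem gate_cross_le (Cg M K : ℝ) : Cg * M * Real.sqrt K ≤ Cg ^ 2 * M ^ 2 + |K| / 4 := by
  rcases le_or_gt K 0 with hK | hK
  · rw [Real.sqrt_eq_zero'.2 hK, mul_zero]
    positivity
  · have hs : Real.sqrt K ^ 2 = K := Real.sq_sqrt hK.le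
    rw [abs_of_pos hK]
    nlinarith [sq_nonneg (Cg * M - Real.sqrt K / 2)]

/-- **Two-sided solve.**  If `|e − K| ≤ D + C_g M √K + |K|/4` then `|K| ≤ 2|e| + 2D + 2C_g²M²`. [folklore] -/
theorem gate_abs_le {e K D Cg M : ℝ} (h : |e - K| ≤ D + Cg * M * Real.sqrt K + |K| / 4) :
    |K| ≤ 2 * |e| + 2 * D + 2 * Cg ^ 2 * M ^ 2 := by
  have h1 : |K| ≤ |e| + |e - K| := by
    have := abs_sub_abs_le_abs_sub K e
    rw [abs_sub_comm] at this
    linarith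
  have h2 := gate_cross_le Cg M K
  linarith

/-- **Lower solve (positivity is an output).**  If `|e − K| ≤ D + C_g M √K + |K|/4` and `e − D − C_g²M² > 0` then
`K ≥ (2/3)(e − D − C_g²M²)` (in particular `K > 0`). [folklore] -/
theorem gate_lower {e K D Cg M : ℝ} (h : |e - K| ≤ D + Cg * M * Real.sqrt K + |K| / 4)
    (hpos : 0 < e - D - Cg ^ 2 * M ^ 2) : 2 / 3 * (e - D - Cg ^ 2 * M ^ 2) ≤ K := by
  have h1 : e - K ≤ D + Cg * M * Real.sqrt K + |K| / 4 := (le_abs_self _).trans h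
  have h2 := gate_cross_le Cg M K
  have h3 : e - D - Cg ^ 2 * M ^ 2 ≤ K + |K| / 2 := by linarith
  rcases le_or_gt 0 K with hK | hK
  · rw [abs_of_nonneg hK] at h3
    linarith
  · rw [abs_of_neg hK] at h3
    linarith

/-- **Transfer through a gate, two-sided**: `|K' − K| ≤ C_g (M √K + M² + |K|/κ²)` with `4C_g ≤ κ²` gives
`|K'| ≤ (3/2)|K| + (C_g + C_g²) M²`. [folklore] -/
theorem gate_transfer_abs_le {K K' Cg M κ : ℝ} (_hCg : 0 ≤ Cg) (hκ : 4 * Cg ≤ κ ^ 2) (hκ0 : 0 < κ)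
    (h : |K' - K| ≤ Cg * (M * Real.sqrt K + M ^ 2 + |K| / κ ^ 2)) :
    |K'| ≤ 3 / 2 * |K| + (Cg + Cg ^ 2) * M ^ 2 := by
  have hK : Cg * (|K| / κ ^ 2) ≤ |K| / 4 := by
    rw [mul_div_assoc', div_le_div_iff₀ (by positivity) (by norm_num : (0 : ℝ) < 4)]
    nlinarith [abs_nonneg K]
  have h1 : |K'| ≤ |K| + |K' - K| := by
    have := abs_sub_abs_le_abs_sub K' K
    linarith
  have h2 := gate_cross_le Cg M K
  have h3 : Cg * (M * Real.sqrt K + M ^ 2 + |K| / κ ^ 2) = Cg * M * Real.sqrt K + Cg * M ^ 2 + Cg * (|K| / κ ^ 2) := by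
    ring
  have h4 : (Cg + Cg ^ 2) * M ^ 2 = Cg * M ^ 2 + Cg ^ 2 * M ^ 2 := by ring
  linarith

/-- **Transfer through a gate, lower side**: `|K' − K| ≤ C_g (M √K + M² + |K|/κ²)` with `4C_g ≤ κ²` and `K ≥ 0`
gives `K' ≥ K/2 − (C_g + C_g²) M²`. [folklore] -/
theorem gate_transfer_lower {K K' Cg M κ : ℝ} (_hCg : 0 ≤ Cg) (hκ : 4 * Cg ≤ κ ^ 2) (hκ0 : 0 < κ) (hK0 : 0 ≤ K)
    (h : |K' - K| ≤ Cg * (M * Real.sqrt K + M ^ 2 + |K| / κ ^ 2)) :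
    K / 2 - (Cg + Cg ^ 2) * M ^ 2 ≤ K' := by
  have hK : Cg * (|K| / κ ^ 2) ≤ |K| / 4 := by
    rw [mul_div_assoc', div_le_div_iff₀ (by positivity) (by norm_num : (0 : ℝ) < 4)]
    nlinarith [abs_nonneg K]
  have h1 : K - K' ≤ |K' - K| := by rw [abs_sub_comm]; exact le_abs_self _
  have h2 := gate_cross_le Cg M K
  have h3 : Cg * (M * Real.sqrt K + M ^ 2 + |K| / κ ^ 2) = Cg * M * Real.sqrt K + Cg * M ^ 2 + Cg * (|K| / κ ^ 2) := by
    ring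
  have h4 : (Cg + Cg ^ 2) * M ^ 2 = Cg * M ^ 2 + Cg ^ 2 * M ^ 2 := by ring
  have habs : |K| = K := abs_of_nonneg hK0
  linarith

/-! ### Depth bookkeeping -/

/-- `C₁ / depth⁴ ≤ C₁ / d⁴` at depth `≥ d > 0`. [folklore] -/
theorem div_depth_le {C₁ d : ℝ} (hC₁ : 0 ≤ C₁) (hd : 0 < d) {D : ℕ} (hD : d ≤ (D : ℝ)) {e : ℝ}
    (he : e ≤ C₁ / (D : ℝ) ^ 4) : e ≤ C₁ / d ^ 4 :=
  he.trans (div_le_div_of_nonneg_left hC₁ (by positivity) (by gcongr))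

/-- Chaining two absolute-value estimates. [folklore] -/
theorem abs_sub_le_add {e I K A B : ℝ} (h1 : |e - I| ≤ A) (h2 : |I - K| ≤ B) : |e - K| ≤ A + B :=
  (abs_sub_le e I K).trans (add_le_add h1 h2)

/-- **Combining the total-covariance estimate with the averaged gate** into the solve form
`|e − K| ≤ (M² + C_g M²) + C_g M √K + |K|/4` (uses `4 C_g ≤ κ²`). [folklore] -/
theorem gate_combine {e I K M Cg κ : ℝ} (hκ : 4 * Cg ≤ κ ^ 2) (hκ0 : 0 < κ)
    (h1 : |e - I| ≤ 4 * (M / 2) * (M / 2)) (h2 : |I - K| ≤ Cg * (M * Real.sqrt K + M ^ 2 + |K| / κ ^ 2)) :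
    |e - K| ≤ (M ^ 2 + Cg * M ^ 2) + Cg * M * Real.sqrt K + |K| / 4 := by
  have h3 := abs_sub_le_add h1 h2
  have hK : Cg * (|K| / κ ^ 2) ≤ |K| / 4 := by
    rw [mul_div_assoc', div_le_div_iff₀ (by positivity) (by norm_num : (0 : ℝ) < 4)]
    nlinarith [abs_nonneg K]
  have e1 : Cg * (M * Real.sqrt K + M ^ 2 + |K| / κ ^ 2) = Cg * M * Real.sqrt K + Cg * M ^ 2 + Cg * (|K| / κ ^ 2) := by
    ring
  have e2 : 4 * (M / 2) * (M / 2) = M ^ 2 := by ring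
  linarith

/-! ### The solve step at one axis pair -/

section Solve

variable (G : Type) [Group G] [TopologicalSpace G] [IsTopologicalGroup G] [CompactSpace G]
  [MeasurableSpace G] [BorelSpace G] (r : LatticeRep G) (a : ℝ → ℝ)

/-- **Reading H1 at an axis pair of a cube.**  From the verbatim femto-box clause of H1, on the torus of side `T`
(`T a ≤ ℓ₀`, `β ≥ β₀`) at separation `m` (`1 ≤ m`, `8m ≤ T`): `c Γ(m a) ≤ m⁸ e ≤ C Γ(m a)` for the lifted
covariance `e` of the `(0,1)`-plane fields at `x'`, `x' + m e₂` (auxiliary file 1, `h1Cov_eq_liftCov`). [folklore] -/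
theorem h1_axis_read {Γ : ℝ → ℝ} {β₀ ℓ₀ c C : ℝ}
    (hbox : ∀ (L : ℕ) [NeZero L] (β : ℝ), β₀ ≤ β → (L : ℝ) * a β ≤ ℓ₀ → let P : (Fin 4 → ZMod L) → Fin 4 → Fin 4 → GaugeConfig 4 L G → ℝ := fun x i j U => (r.N : ℝ) - (r.ρ (plaquetteHolonomy U x i j)).trace.re; let E : (GaugeConfig 4 L G → ℝ) → ℝ := fun F => wilsonExpectation (d := 4) (L := L) r.ρ β F; let cov : (GaugeConfig 4 L G → ℝ) → (GaugeConfig 4 L G → ℝ) → ℝ := fun F F' => E (fun U => F U * F' U) - E F * E F'; let dist : (Fin 4 → ZMod L) → (Fin 4 → ZMod L) → ℝ := fun x y => Real.sqrt (∑ k : Fin 4, (((x k - y k).valMinAbs : ℤ) : ℝ) ^ 2); (∀ n : ℕ, 1 ≤ n → 8 * n ≤ L → c * Γ ((n : ℝ) * a β) ≤ (n : ℝ) ^ 8 * cov (P 0 0 1) (P (Pi.single (2 : Fin 4) ((n : ℕ) : ZMod L)) 0 1) ∧ (n : ℝ) ^ 8 * cov (P 0 0 1) (P (Pi.single (2 :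 Fin 4) ((n : ℕ) : ZMod L)) 0 1) ≤ C * Γ ((n : ℝ) * a β)) ∧ (∀ (x y : Fin 4 → ZMod L) (i j i' j' : Fin 4), x ≠ y → i ≠ j → i' ≠ j' → |cov (P x i j) (P y i' j')| * dist x y ^ 8 ≤ C * Γ (dist x y * a β)))
    {β : ℝ} (hβ₀ : β₀ ≤ β) (T : ℕ) [NeZero T] (hfem : (T : ℝ) * a β ≤ ℓ₀) {m : ℕ} (hm1 : 1 ≤ m)
    (h8m : 8 * m ≤ T) (x' : Fin 4 → ℤ) :
    c * Γ ((m : ℝ) * a β) ≤ (m : ℝ) ^ 8 *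
        ((∫ U, plane G r (0, 1) x' (torusLift T U) * plane G r (0, 1) (x' + Pi.single (2 : Fin 4) (m : ℤ)) (torusLift T U)
            ∂(wilsonMeasure (d := 4) (L := T) r.ρ β)) -
          (∫ U, plane G r (0, 1) x' (torusLift T U) ∂(wilsonMeasure (d := 4) (L := T) r.ρ β)) *
            (∫ U, plane G r (0, 1) (x' + Pi.single (2 : Fin 4) (m : ℤ)) (torusLift T U)
              ∂(wilsonMeasure (d := 4) (L := T) r.ρ β))) ∧
      (m : ℝ) ^ 8 *
        ((∫ U, plane G r (0, 1) x' (torusLift T U) * plane G r (0, 1) (x' + Pi.single (2 : Fin 4) (m : ℤ)) (torusLift T U)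
            ∂(wilsonMeasure (d := 4) (L := T) r.ρ β)) -
          (∫ U, plane G r (0, 1) x' (torusLift T U) ∂(wilsonMeasure (d := 4) (L := T) r.ρ β)) *
            (∫ U, plane G r (0, 1) (x' + Pi.single (2 : Fin 4) (m : ℤ)) (torusLift T U)
              ∂(wilsonMeasure (d := 4) (L := T) r.ρ β))) ≤ C * Γ ((m : ℝ) * a β) := by
  obtain ⟨hax, -⟩ := hbox T β hβ₀ hfem
  obtain ⟨hlo, hup⟩ := hax m hm1 h8m
  have ecov := h1Cov_eq_liftCov G r β T m x'
  simp only [] at hlo hup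
  rw [ecov] at hlo hup
  exact ⟨hlo, hup⟩

/-- **The gate budget from FBL6.**  On a femto cube, for every exterior `η`, every orientation and every site at
depth `≥ d ≥ 2`, the shift of the plane mean relative to the FLAT exterior is at most `2 C₁ / d⁴`. [folklore] -/
theorem budget_of_fbl6 {C₁ ℓ₁ β : ℝ} {p : Fin 4 × Fin 4 → ℝ → ℝ} (hC₁ : 0 ≤ C₁)
    (hF : ∀ (c : Fin 4 → ℤ) (b : ℕ), (b : ℝ) * a β ≤ ℓ₁ →
      ∀ (η : LGConfig 4 G) (q : Fin 4 × Fin 4) (x : Fin 4 → ℤ), q.1 < q.2 → 2 ≤ depth c b x →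
        |kerE G r β c b η (plane G r q x) - p q β| ≤ C₁ / (depth c b x : ℝ) ^ 4)
    {cc : Fin 4 → ℤ} {b : ℕ} (hb : (b : ℝ) * a β ≤ ℓ₁) {d : ℝ} (hd2 : 2 ≤ d)
    (η : LGConfig 4 G) (q : Fin 4 × Fin 4) (z : Fin 4 → ℤ) (hq : q.1 < q.2) (hz : d ≤ (depth cc b z : ℝ)) :
    |kerE G r β cc b η (plane G r q z) - kerE G r β cc b 1 (plane G r q z)| ≤ 2 * C₁ / d ^ 4 := by
  have hz2 : 2 ≤ depth cc b z := by
    have : (2 : ℝ) ≤ depth cc b z := hd2.trans hz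
    exact_mod_cast this
  have hd0 : 0 < d := by linarith
  have h1 := div_depth_le hC₁ hd0 hz (hF cc b hb η q z hq hz2)
  have h2 := div_depth_le hC₁ hd0 hz (hF cc b hb 1 q z hq hz2)
  rw [abs_sub_comm] at h2
  have := abs_sub_le (kerE G r β cc b η (plane G r q z)) (p q β) (kerE G r β cc b 1 (plane G r q z))
  have e : 2 * C₁ / d ^ 4 = C₁ / d ^ 4 + C₁ / d ^ 4 := by ring
  linarith

/-- **The solved gate at one axis pair (core of the solve step).**  With the data of `flatAxis_bounds`, the lifted
torus covariance `e` of the pair satisfies `c Γ(m a) ≤ m⁸ e ≤ C Γ(m a)`, `0 < Γ(m a) ≤ 1`, and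
`|e − K(1)| ≤ (1 + C_g) M² + C_g M √K(1) + |K(1)|/4` with `M = 2 C₁ / ((κ−2) m)⁴`. [folklore] -/
theorem flatAxis_gate
    {Γ : ℝ → ℝ} {β₀ ℓ₀ c C : ℝ} (hΓ : ∀ s : ℝ, 0 < s → s ≤ ℓ₀ → 0 < Γ s ∧ Γ s ≤ 1)
    (hbox : ∀ (L : ℕ) [NeZero L] (β : ℝ), β₀ ≤ β → (L : ℝ) * a β ≤ ℓ₀ → let P : (Fin 4 → ZMod L) → Fin 4 → Fin 4 → GaugeConfig 4 L G → ℝ := fun x i j U => (r.N : ℝ) - (r.ρ (plaquetteHolonomy U x i j)).trace.re; let E : (GaugeConfig 4 L G → ℝ) → ℝ := fun F => wilsonExpectation (d := 4) (L := L) r.ρ β F; let cov : (GaugeConfig 4 L G → ℝ) → (GaugeConfig 4 L G → ℝ) → ℝ := fun F F' => E (fun U => F U * F' U) - E F * E F'; let dist : (Fin 4 → ZMod L) → (Fin 4 → ZMod L) → ℝ := fun x y => Real.sqrt (∑ k : Fin 4, (((x k - y k).valMinAbs : ℤ) : ℝ) ^ 2); (∀ n : ℕ, 1 ≤ n → 8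 * n ≤ L → c * Γ ((n : ℝ) * a β) ≤ (n : ℝ) ^ 8 * cov (P 0 0 1) (P (Pi.single (2 : Fin 4) ((n : ℕ) : ZMod L)) 0 1) ∧ (n : ℝ) ^ 8 * cov (P 0 0 1) (P (Pi.single (2 : Fin 4) ((n : ℕ) : ZMod L)) 0 1) ≤ C * Γ ((n : ℝ) * a β)) ∧ (∀ (x y : Fin 4 → ZMod L) (i j i' j' : Fin 4), x ≠ y → i ≠ j → i' ≠ j' → |cov (P x i j) (P y i' j')| * dist x y ^ 8 ≤ C * Γ (dist x y * a β)))
    {C₁ β₁ ℓ₁ : ℝ} {p : Fin 4 × Fin 4 → ℝ → ℝ} (hC₁ : 0 ≤ C₁)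
    (hFBL : ∀ β : ℝ, β₁ ≤ β → ∀ (c : Fin 4 → ℤ) (b : ℕ), (b : ℝ) * a β ≤ ℓ₁ →
      ∀ (η : LGConfig 4 G) (q : Fin 4 × Fin 4) (x : Fin 4 → ℤ), q.1 < q.2 → 2 ≤ depth c b x →
        |kerE G r β c b η (plane G r q x) - p q β| ≤ C₁ / (depth c b x : ℝ) ^ 4)
    {Cg β₆ ℓ₆ : ℝ} {n₆ : ℕ}
    (hGA : ∀ β : ℝ, β₆ ≤ β → ∀ κ : ℕ, 8 ≤ κ →
      ∀ (c : Fin 4 → ℤ) (b : ℕ), (b : ℝ) * a β ≤ ℓ₆ → ∀ (η : LGConfig 4 G) (x : Fin 4 → ℤ) (n : ℕ), n₆ ≤ n →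
        κ * n ≤ depth c b x → κ * n ≤ depth c b (x + Pi.single (2 : Fin 4) (n : ℤ)) →
        ∀ M : ℝ, 0 ≤ M →
          (∀ (q : Fin 4 × Fin 4) (z : Fin 4 → ℤ), q.1 < q.2 → (κ - 2) * n ≤ depth c b z →
            |kerE G r β c b η (plane G r q z) - kerE G r β c b 1 (plane G r q z)| ≤ M) →
          |kerCov G r β c b η (plane G r (0, 1) x) (plane G r (0, 1) (x + Pi.single (2 : Fin 4) (n : ℤ))) -
              kerCov G r β c b 1 (plane G r (0, 1) x) (plane G r (0, 1) (x + Pi.single (2 : Fin 4) (n : ℤ)))| ≤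
            Cg * (M * Real.sqrt (kerCov G r β c b 1 (plane G r (0, 1) x) (plane G r (0, 1) (x + Pi.single (2 : Fin 4) (n : ℤ)))) +
              M ^ 2 + |kerCov G r β c b 1 (plane G r (0, 1) x) (plane G r (0, 1) (x + Pi.single (2 : Fin 4) (n : ℤ)))| / (κ : ℝ) ^ 2))
    {β : ℝ} (hβ₀ : β₀ ≤ β) (hβ₁ : β₁ ≤ β) (hβ₆ : β₆ ≤ β) (hα : 0 < a β)
    {cc : Fin 4 → ℤ} {b : ℕ} (hb₁ : (b : ℝ) * a β ≤ ℓ₁) (hb₆ : (b : ℝ) * a β ≤ ℓ₆)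
    (hb₀ : ((b : ℝ) + 3) * a β ≤ ℓ₀)
    {κ : ℕ} (hκ8 : 8 ≤ κ) (hκCg : 4 * Cg ≤ (κ : ℝ) ^ 2)
    {x' : Fin 4 → ℤ} {m : ℕ} (hm1 : 1 ≤ m) (hmn₆ : n₆ ≤ m) (h8m : 8 * m ≤ b + 3)
    (hdx : κ * m ≤ depth cc b x') (hdx' : κ * m ≤ depth cc b (x' + Pi.single (2 : Fin 4) (m : ℤ))) :
    ∃ e M : ℝ, M = 2 * C₁ / (((κ : ℝ) - 2) * m) ^ 4 ∧
      c * Γ ((m : ℝ) * a β) ≤ (m : ℝ) ^ 8 * e ∧ (m : ℝ) ^ 8 * e ≤ C * Γ ((m : ℝ) * a β) ∧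
      0 < Γ ((m : ℝ) * a β) ∧ Γ ((m : ℝ) * a β) ≤ 1 ∧
      |e - kerCov G r β cc b 1 (plane G r (0, 1) x') (plane G r (0, 1) (x' + Pi.single (2 : Fin 4) (m : ℤ)))| ≤
        (M ^ 2 + Cg * M ^ 2) +
          Cg * M * Real.sqrt (kerCov G r β cc b 1 (plane G r (0, 1) x') (plane G r (0, 1) (x' + Pi.single (2 : Fin 4) (m : ℤ)))) +
          |kerCov G r β cc b 1 (plane G r (0, 1) x') (plane G r (0, 1) (x' + Pi.single (2 : Fin 4) (m : ℤ)))| / 4 := by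
  haveI : NeZero (b + 3) := ⟨by omega⟩
  have hm0 : (0 : ℝ) < m := by exact_mod_cast hm1
  have hκr : (8 : ℝ) ≤ κ := by exact_mod_cast hκ8
  have hκ2 : (6 : ℝ) ≤ (κ : ℝ) - 2 := by linarith only [hκr]
  have hκ0 : (0 : ℝ) < κ := by linarith only [hκr]
  -- the budget `M` and the boundary term `h ≤ M/2`
  obtain ⟨M, hM⟩ : ∃ M : ℝ, M = 2 * C₁ / (((κ : ℝ) - 2) * m) ^ 4 := ⟨_, rfl⟩
  have hM0 : 0 ≤ M := by rw [hM]; positivity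
  have hd2 : ((κ : ℝ) - 2) * m = (((κ - 2) * m : ℕ) : ℝ) := by
    push_cast [Nat.cast_sub (by omega : 2 ≤ κ)]; ring
  have hdm : (κ : ℝ) * m = ((κ * m : ℕ) : ℝ) := by push_cast; ring
  have hdepth1 : ∀ {z : Fin 4 → ℤ}, κ * m ≤ depth cc b z → 1 ≤ depth cc b z := fun hz =>
    le_trans (le_trans hm1 (Nat.le_mul_of_pos_left m (by omega))) hz
  have hdepth2 : ∀ {z : Fin 4 → ℤ}, κ * m ≤ depth cc b z → 2 ≤ depth cc b z := fun hz =>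
    le_trans (le_trans (by norm_num : 2 ≤ 8 * 1) (Nat.mul_le_mul hκ8 hm1)) hz
  have hends : ∀ {z : Fin 4 → ℤ}, κ * m ≤ depth cc b z → ∀ η,
      |kerE G r β cc b η (plane G r (0, 1) z) - p (0, 1) β| ≤ M / 2 := by
    intro z hz η
    have h := hFBL β hβ₁ cc b hb₁ η (0, 1) z (by decide) (hdepth2 hz)
    have h' : |kerE G r β cc b η (plane G r (0, 1) z) - p (0, 1) β| ≤ C₁ / ((κ : ℝ) * m) ^ 4 := by
      refine div_depth_le hC₁ (by positivity) ?_ h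
      rw [hdm]; exact_mod_cast hz
    refine h'.trans ?_
    have e : M / 2 = C₁ / (((κ : ℝ) - 2) * m) ^ 4 := by rw [hM]; ring
    rw [e]
    refine div_le_div_of_nonneg_left hC₁ (by positivity) ?_
    have h0 : 0 ≤ ((κ : ℝ) - 2) * m := by positivity
    have h1 : ((κ : ℝ) - 2) * m ≤ (κ : ℝ) * m := by nlinarith only [hm0]
    exact pow_le_pow_left₀ h0 h1 4
  -- the budget of the gate, every exterior
  have hbudget : ∀ (η : LGConfig 4 G) (q : Fin 4 × Fin 4) (z : Fin 4 → ℤ), q.1 < q.2 →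
      (κ - 2) * m ≤ depth cc b z →
      |kerE G r β cc b η (plane G r q z) - kerE G r β cc b 1 (plane G r q z)| ≤ M := by
    intro η q z hq hz
    have hzr : ((κ : ℝ) - 2) * m ≤ (depth cc b z : ℝ) := by rw [hd2]; exact_mod_cast hz
    have hm1r : (1 : ℝ) ≤ m := by exact_mod_cast hm1
    have h2d : (2 : ℝ) ≤ ((κ : ℝ) - 2) * m := by
      have := mul_le_mul hκ2 hm1r (by norm_num) (by linarith only [hκ2])
      linarith only [this]
    have h := budget_of_fbl6 G r a hC₁ (hFBL β hβ₁) hb₁ h2d η q z hq hzr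
    rw [hM]; exact h
  -- GateAxis, every exterior; then averaged over the torus
  have hgate := fun η : LGConfig 4 G =>
    hGA β hβ₆ κ hκ8 cc b hb₆ η x' m hmn₆ hdx hdx' M hM0 (fun q z hq hz => hbudget η q z hq hz)
  have havg := abs_integral_kerCov_plane_sub_le G r β cc b (b + 3) (0, 1) (0, 1) _ _ hgate
  -- total covariance on the torus of side `b + 3`
  have htot := abs_liftCov_plane_sub_integral_kerCov_le G r β cc b (b + 3) (le_refl _) (0, 1) (0, 1)
    (hdepth1 hdx) (hdepth1 hdx') (hends hdx) (hends hdx')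
  -- H1 read at the pair
  have hfem : ((b + 3 : ℕ) : ℝ) * a β ≤ ℓ₀ := by push_cast; exact hb₀
  obtain ⟨hlo, hup⟩ := h1_axis_read G r a hbox hβ₀ (b + 3) hfem hm1 h8m x'
  -- the shape function at the scale `m a`
  have hsℓ : (m : ℝ) * a β ≤ ℓ₀ := by
    have h8 : (8 : ℝ) * m ≤ (b : ℝ) + 3 := by exact_mod_cast h8m
    have hma : 0 < (m : ℝ) * a β := mul_pos hm0 hα
    nlinarith only [h8, hma, hb₀, hα]
  obtain ⟨hΓpos, hΓ1⟩ := hΓ _ (mul_pos hm0 hα) hsℓ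
  exact ⟨_, M, hM, hlo, hup, hΓpos, hΓ1, gate_combine hκCg hκ0 htot havg⟩

/-- **The flat axis covariance pinned by H1 (solve step of `stub_inherit`).**  Data: H1's shape function and
constants with the verbatim femto-box clause; FBL6's constants and its all-exterior one-point law for the plane
fields; `GateAxis`'s constant `C_g` and its clause.  Instance: `β` past the three thresholds, a cube `(c, b)` with
`b a ≤ ℓ₁`, `b a ≤ ℓ₆`, `(b + 3) a ≤ ℓ₀`, a gate parameter `κ ≥ 8` with `4 C_g ≤ κ²`, and an axis pair
`(x', x' + m e₂)` with `1 ≤ m`, `n₆ ≤ m`, `8 m ≤ b + 3`, both ends at depth `≥ κ m`.  Then, with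
`B = 4 (1 + C_g + C_g²) C₁² / ((κ − 2) m)⁸`:
(U) `m⁸ |K(1)| ≤ 2 C + 2 m⁸ B`;  (L) if `Γ(m a) ≥ K_f (m a)⁸` and `c K_f a⁸ > B` then `K(1) ≥ (2/3)(c K_f a⁸ − B)`. [folklore] -/
theorem flatAxis_bounds
    {Γ : ℝ → ℝ} {β₀ ℓ₀ c C : ℝ} (hc : 0 < c) (hΓ : ∀ s : ℝ, 0 < s → s ≤ ℓ₀ → 0 < Γ s ∧ Γ s ≤ 1)
    (hbox : ∀ (L : ℕ) [NeZero L] (β : ℝ), β₀ ≤ β → (L : ℝ) * a β ≤ ℓ₀ → let P : (Fin 4 → ZMod L) → Fin 4 → Fin 4 → GaugeConfig 4 L G → ℝ := fun x i j U => (r.N : ℝ) - (r.ρ (plaquetteHolonomy U x i j)).trace.re; let E : (GaugeConfig 4 L G → ℝ) → ℝ := fun F => wilsonExpectation (d := 4) (L := L) r.ρ β F; let cov : (GaugeConfig 4 L G → ℝ) → (GaugeConfig 4 L G → ℝ) → ℝ := fun F F' => E (fun U => F U * F' U) - E F * E F'; let dist : (Fin 4 → ZMod L) → (Fin 4 → ZMod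 L) → ℝ := fun x y => Real.sqrt (∑ k : Fin 4, (((x k - y k).valMinAbs : ℤ) : ℝ) ^ 2); (∀ n : ℕ, 1 ≤ n → 8 * n ≤ L → c * Γ ((n : ℝ) * a β) ≤ (n : ℝ) ^ 8 * cov (P 0 0 1) (P (Pi.single (2 : Fin 4) ((n : ℕ) : ZMod L)) 0 1) ∧ (n : ℝ) ^ 8 * cov (P 0 0 1) (P (Pi.single (2 : Fin 4) ((n : ℕ) : ZMod L)) 0 1) ≤ C * Γ ((n : ℝ) * a β)) ∧ (∀ (x y : Fin 4 → ZMod L) (i j i' j' : Fin 4), x ≠ y → i ≠ j → i' ≠ j' → |cov (P x i j) (P y i' j')| * dist x y ^ 8 ≤ C * Γ (dist x y * a β)))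
    {C₁ β₁ ℓ₁ : ℝ} {p : Fin 4 × Fin 4 → ℝ → ℝ} (hC₁ : 0 ≤ C₁)
    (hFBL : ∀ β : ℝ, β₁ ≤ β → ∀ (c : Fin 4 → ℤ) (b : ℕ), (b : ℝ) * a β ≤ ℓ₁ →
      ∀ (η : LGConfig 4 G) (q : Fin 4 × Fin 4) (x : Fin 4 → ℤ), q.1 < q.2 → 2 ≤ depth c b x →
        |kerE G r β c b η (plane G r q x) - p q β| ≤ C₁ / (depth c b x : ℝ) ^ 4)
    {Cg β₆ ℓ₆ : ℝ} {n₆ : ℕ}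
    (hGA : ∀ β : ℝ, β₆ ≤ β → ∀ κ : ℕ, 8 ≤ κ →
      ∀ (c : Fin 4 → ℤ) (b : ℕ), (b : ℝ) * a β ≤ ℓ₆ → ∀ (η : LGConfig 4 G) (x : Fin 4 → ℤ) (n : ℕ), n₆ ≤ n →
        κ * n ≤ depth c b x → κ * n ≤ depth c b (x + Pi.single (2 : Fin 4) (n : ℤ)) →
        ∀ M : ℝ, 0 ≤ M →
          (∀ (q : Fin 4 × Fin 4) (z : Fin 4 → ℤ), q.1 < q.2 → (κ - 2) * n ≤ depth c b z →
            |kerE G r β c b η (plane G r q z) - kerE G r β c b 1 (plane G r q z)| ≤ M) →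
          |kerCov G r β c b η (plane G r (0, 1) x) (plane G r (0, 1) (x + Pi.single (2 : Fin 4) (n : ℤ))) -
              kerCov G r β c b 1 (plane G r (0, 1) x) (plane G r (0, 1) (x + Pi.single (2 : Fin 4) (n : ℤ)))| ≤
            Cg * (M * Real.sqrt (kerCov G r β c b 1 (plane G r (0, 1) x) (plane G r (0, 1) (x + Pi.single (2 : Fin 4) (n : ℤ)))) +
              M ^ 2 + |kerCov G r β c b 1 (plane G r (0, 1) x) (plane G r (0, 1) (x + Pi.single (2 : Fin 4) (n : ℤ)))| / (κ : ℝ) ^ 2))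
    {β : ℝ} (hβ₀ : β₀ ≤ β) (hβ₁ : β₁ ≤ β) (hβ₆ : β₆ ≤ β) (hα : 0 < a β)
    {cc : Fin 4 → ℤ} {b : ℕ} (hb₁ : (b : ℝ) * a β ≤ ℓ₁) (hb₆ : (b : ℝ) * a β ≤ ℓ₆)
    (hb₀ : ((b : ℝ) + 3) * a β ≤ ℓ₀)
    {κ : ℕ} (hκ8 : 8 ≤ κ) (hκCg : 4 * Cg ≤ (κ : ℝ) ^ 2)
    {x' : Fin 4 → ℤ} {m : ℕ} (hm1 : 1 ≤ m) (hmn₆ : n₆ ≤ m) (h8m : 8 * m ≤ b + 3)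
    (hdx : κ * m ≤ depth cc b x') (hdx' : κ * m ≤ depth cc b (x' + Pi.single (2 : Fin 4) (m : ℤ))) :
    ((m : ℝ) ^ 8 * |kerCov G r β cc b 1 (plane G r (0, 1) x') (plane G r (0, 1) (x' + Pi.single (2 : Fin 4) (m : ℤ)))| ≤
        2 * C + 2 * (m : ℝ) ^ 8 * (4 * (1 + Cg + Cg ^ 2) * C₁ ^ 2 / (((κ : ℝ) - 2) * m) ^ 8)) ∧
      (∀ Kf : ℝ, Kf * ((m : ℝ) * a β) ^ 8 ≤ Γ ((m : ℝ) * a β) →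
        4 * (1 + Cg + Cg ^ 2) * C₁ ^ 2 / (((κ : ℝ) - 2) * m) ^ 8 < c * Kf * a β ^ 8 →
        2 / 3 * (c * Kf * a β ^ 8 - 4 * (1 + Cg + Cg ^ 2) * C₁ ^ 2 / (((κ : ℝ) - 2) * m) ^ 8) ≤
          kerCov G r β cc b 1 (plane G r (0, 1) x') (plane G r (0, 1) (x' + Pi.single (2 : Fin 4) (m : ℤ)))) := by
  obtain ⟨e, M, hM, hlo, hup, hΓpos, hΓ1, hkey⟩ := flatAxis_gate G r a hΓ hbox hC₁ hFBL hGA hβ₀ hβ₁ hβ₆ hα hb₁ hb₆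
    hb₀ hκ8 hκCg hm1 hmn₆ h8m hdx hdx'
  have hm0 : (0 : ℝ) < m := by exact_mod_cast hm1
  have hκr : (8 : ℝ) ≤ κ := by exact_mod_cast hκ8
  -- name the flat value
  obtain ⟨K1, hK1⟩ : ∃ K1 : ℝ, kerCov G r β cc b 1 (plane G r (0, 1) x')
    (plane G r (0, 1) (x' + Pi.single (2 : Fin 4) (m : ℤ))) = K1 := ⟨_, rfl⟩
  rw [hK1] at hkey ⊢
  have hB : (1 + Cg + Cg ^ 2) * M ^ 2 = 4 * (1 + Cg + Cg ^ 2) * C₁ ^ 2 / (((κ : ℝ) - 2) * m) ^ 8 := by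
    rw [hM]
    have h0 : (((κ : ℝ) - 2) * m) ≠ 0 := by
      have : (0:ℝ) < ((κ : ℝ) - 2) * m := by nlinarith only [hκr, hm0]
      exact this.ne'
    field_simp
    ring
  have hm8 : (0 : ℝ) < (m : ℝ) ^ 8 := by positivity
  refine ⟨?_, fun Kf hKf hposB => ?_⟩
  · -- (U)
    have habs := gate_abs_le hkey
    have he0 : 0 ≤ e := by
      have h1 : 0 < c * Γ ((m : ℝ) * a β) := mul_pos hc hΓpos
      have h2 : 0 < (m : ℝ) ^ 8 * e := h1.trans_le hlo
      exact (pos_of_mul_pos_right h2 hm8.le).le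
    have hC0 : 0 ≤ C := by
      have h1 : 0 < c * Γ ((m : ℝ) * a β) := mul_pos hc hΓpos
      have h2 : 0 < C * Γ ((m : ℝ) * a β) := h1.trans_le (hlo.trans hup)
      exact (pos_of_mul_pos_left h2 hΓpos.le).le
    have heC : (m : ℝ) ^ 8 * |e| ≤ C := by
      rw [abs_of_nonneg he0]
      have : C * Γ ((m : ℝ) * a β) ≤ C := by nlinarith only [hC0, hΓ1, hΓpos]
      exact hup.trans this
    calc (m : ℝ) ^ 8 * |K1| ≤ (m : ℝ) ^ 8 * (2 * |e| + 2 * (M ^ 2 + Cg * M ^ 2) + 2 * Cg ^ 2 * M ^ 2) :=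
          mul_le_mul_of_nonneg_left habs hm8.le
      _ = 2 * ((m : ℝ) ^ 8 * |e|) + 2 * (m : ℝ) ^ 8 * ((1 + Cg + Cg ^ 2) * M ^ 2) := by ring
      _ ≤ 2 * C + 2 * (m : ℝ) ^ 8 * (4 * (1 + Cg + Cg ^ 2) * C₁ ^ 2 / (((κ : ℝ) - 2) * m) ^ 8) := by
          rw [hB]; linarith only [heC]
  · -- (L)
    have he1 : c * Kf * a β ^ 8 ≤ e := by
      have h1 : c * (Kf * ((m : ℝ) * a β) ^ 8) ≤ c * Γ ((m : ℝ) * a β) := mul_le_mul_of_nonneg_left hKf hc.le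
      have h2 : (m : ℝ) ^ 8 * (c * Kf * a β ^ 8) ≤ (m : ℝ) ^ 8 * e := by
        calc (m : ℝ) ^ 8 * (c * Kf * a β ^ 8) = c * (Kf * ((m : ℝ) * a β) ^ 8) := by ring
          _ ≤ _ := h1.trans hlo
      exact le_of_mul_le_mul_left h2 hm8
    have hpos' : 0 < e - (M ^ 2 + Cg * M ^ 2) - Cg ^ 2 * M ^ 2 := by
      have e3 : (M ^ 2 + Cg * M ^ 2) + Cg ^ 2 * M ^ 2 = (1 + Cg + Cg ^ 2) * M ^ 2 := by ring
      rw [hB] at e3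
      linarith only [he1, hposB, e3]
    have h := gate_lower hkey hpos'
    have e2 : e - (M ^ 2 + Cg * M ^ 2) - Cg ^ 2 * M ^ 2 = e - (1 + Cg + Cg ^ 2) * M ^ 2 := by ring
    rw [e2, hB] at h
    linarith only [h, he1]

end Solve

end StubInherit

/-! ### Registered sub-goal (closed form) -/

/-- **The flat axis covariance pinned by H1 — registered sub-goal `flatAxisBounds` of crux stmt-QuantumFields-16207
(line `inherited-amplitude-gates`, stub `stub_inherit`), closed form of `StubInherit.flatAxis_bounds`.**  From H1's
two-sided femto-torus bounds, FBL6's all-exterior one-point law and the η-relative gate `GateAxis` (as clauses with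
their constants): the flat-box conditional covariance `K(1)` of a deep `(0,1)`-plane axis pair of any femto cube obeys
(U) `m⁸ |K(1)| ≤ 2C + 2 m⁸ B` and (L) `K(1) ≥ (2/3)(c K_f a⁸ − B)` whenever `Γ(m a) ≥ K_f (m a)⁸` and `c K_f a⁸ > B`,
`B = 4 (1 + C_g + C_g²) C₁² / ((κ − 2) m)⁸`. [folklore] -/
theorem flatAxisBounds : ∀ (G : Type) [Group G] [TopologicalSpace G] [IsTopologicalGroup G] [CompactSpace G] [MeasurableSpace G] [BorelSpace G] (r : LatticeRep G) (a Γ : ℝ → ℝ) (β₀ ℓ₀ c C : ℝ), 0 < c → (∀ s : ℝ, 0 < s → s ≤ ℓ₀ → 0 < Γ s ∧ Γ s ≤ 1) → (∀ (L : ℕ) [NeZero L] (β : ℝ), β₀ ≤ β → (L : ℝ) * a β ≤ ℓ₀ → let P : (Fin 4 → ZMod L) → Fin 4 → Fin 4 → GaugeConfig 4 L G → ℝ := fun x i j U => (r.N : ℝ) - (r.ρ (plaquetteHolonomy U x i j)).trace.re; let E : (GaugeConfig 4 L G → ℝ) → ℝ := fun F => wilsonExpectation (d := 4) (L := L) r.ρ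 β F; let cov : (GaugeConfig 4 L G → ℝ) → (GaugeConfig 4 L G → ℝ) → ℝ := fun F F' => E (fun U => F U * F' U) - E F * E F'; let dist : (Fin 4 → ZMod L) → (Fin 4 → ZMod L) → ℝ := fun x y => Real.sqrt (∑ k : Fin 4, (((x k - y k).valMinAbs : ℤ) : ℝ) ^ 2); (∀ n : ℕ, 1 ≤ n → 8 * n ≤ L → c * Γ ((n : ℝ) * a β) ≤ (n : ℝ) ^ 8 * cov (P 0 0 1) (P (Pi.single (2 : Fin 4) ((n : ℕ) : ZMod L)) 0 1) ∧ (n : ℝ) ^ 8 * cov (P 0 0 1) (P (Pi.single (2 : Fin 4) ((n : ℕ) : ZMod L)) 0 1) ≤ C * Γ ((n : ℝ) * a β)) ∧ (∀ (x y : Fin 4 → ZMod L) (i j i' j' : Fin 4), x ≠ y → i ≠ j → i' ≠ j' → |cov (P x i j) (P y i' j')| * dist x y ^ 8 ≤ C * Γ (dist x y * a β))) → ∀ (C₁ β₁ ℓ₁ : ℝ) (p : Fin 4 × Fin 4 → ℝ → ℝ), 0 ≤ C₁ → (∀ β : ℝ, β₁ ≤ β → ∀ (c : Fin 4 → ℤ)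 (b : ℕ), (b : ℝ) * a β ≤ ℓ₁ → ∀ (η : LGConfig 4 G) (q : Fin 4 × Fin 4) (x : Fin 4 → ℤ), q.1 < q.2 → 2 ≤ depth c b x → |kerE G r β c b η (plane G r q x) - p q β| ≤ C₁ / (depth c b x : ℝ) ^ 4) → ∀ (Cg β₆ ℓ₆ : ℝ) (n₆ : ℕ), (∀ β : ℝ, β₆ ≤ β → ∀ κ : ℕ, 8 ≤ κ → ∀ (c : Fin 4 → ℤ) (b : ℕ), (b : ℝ) * a β ≤ ℓ₆ → ∀ (η : LGConfig 4 G) (x : Fin 4 → ℤ) (n : ℕ), n₆ ≤ n → κ * n ≤ depth c b x → κ * n ≤ depth c b (x + Pi.single (2 : Fin 4) (n : ℤ)) → ∀ M : ℝ, 0 ≤ M → (∀ (q : Fin 4 × Fin 4) (z : Fin 4 → ℤ), q.1 < q.2 → (κ - 2) * n ≤ depth c b z → |kerE G r β c b η (plane G r q z) - kerE G r β c b 1 (plane G r q z)| ≤ M) → |kerCov G r β c b η (plane G r (0, 1) x) (plane G r (0, 1) (x + Pi.single (2 : Fin 4) (n : ℤ))) - kerCov G r β c b 1 (plane G r (0,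 1) x) (plane G r (0, 1) (x + Pi.single (2 : Fin 4) (n : ℤ)))| ≤ Cg * (M * Real.sqrt (kerCov G r β c b 1 (plane G r (0, 1) x) (plane G r (0, 1) (x + Pi.single (2 : Fin 4) (n : ℤ)))) + M ^ 2 + |kerCov G r β c b 1 (plane G r (0, 1) x) (plane G r (0, 1) (x + Pi.single (2 : Fin 4) (n : ℤ)))| / (κ : ℝ) ^ 2)) → ∀ (β : ℝ), β₀ ≤ β → β₁ ≤ β → β₆ ≤ β → 0 < a β → ∀ (cc : Fin 4 → ℤ) (b : ℕ), (b : ℝ) * a β ≤ ℓ₁ → (b : ℝ) * a β ≤ ℓ₆ → ((b : ℝ) + 3) * a β ≤ ℓ₀ → ∀ (κ : ℕ), 8 ≤ κ → 4 * Cg ≤ (κ : ℝ) ^ 2 → ∀ (x' : Fin 4 → ℤ) (m : ℕ), 1 ≤ m → n₆ ≤ m → 8 * m ≤ b + 3 → κ * m ≤ depth cc b x' → κ * m ≤ depth cc b (x' + Pi.single (2 : Fin 4) (m : ℤ)) → ((m : ℝ) ^ 8 * |kerCov G r β cc b 1 (plane G r (0, 1) x') (plane G r (0, 1) (x' + Pi.single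 (2 : Fin 4) (m : ℤ)))| ≤ 2 * C + 2 * (m : ℝ) ^ 8 * (4 * (1 + Cg + Cg ^ 2) * C₁ ^ 2 / (((κ : ℝ) - 2) * m) ^ 8)) ∧ (∀ Kf : ℝ, Kf * ((m : ℝ) * a β) ^ 8 ≤ Γ ((m : ℝ) * a β) → 4 * (1 + Cg + Cg ^ 2) * C₁ ^ 2 / (((κ : ℝ) - 2) * m) ^ 8 < c * Kf * a β ^ 8 → 2 / 3 * (c * Kf * a β ^ 8 - 4 * (1 + Cg + Cg ^ 2) * C₁ ^ 2 / (((κ : ℝ) - 2) * m) ^ 8) ≤ kerCov G r β cc b 1 (plane G r (0, 1) x') (plane G r (0, 1) (x' + Pi.single (2 : Fin 4) (m : ℤ)))) := by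
  intro G _ _ _ _ _ _ r a Γ β₀ ℓ₀ c C hc hΓ hbox C₁ β₁ ℓ₁ p hC₁ hFBL Cg β₆ ℓ₆ n₆ hGA β hβ₀ hβ₁ hβ₆ hα cc b hb₁ hb₆ hb₀ κ hκ8
    hκCg x' m hm1 hmn₆ h8m hdx hdx'
  exact StubInherit.flatAxis_bounds G r a hc hΓ hbox hC₁ hFBL hGA hβ₀ hβ₁ hβ₆ hα hb₁ hb₆ hb₀ hκ8 hκCg hm1 hmn₆ h8m hdx hdx'

end Summit.QuantumFields.YangMills.Cruxes.OSLegsAtWeakCouplingC.InheritedAmplitudeGates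

end
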